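import Literature.Analysis.FluidPDE.BilliardTensorMeasureDivFree
import HarnessLib

/-!
# `Div M` of Serre's billiard tensor measure is carried by the time slices ((16), measure form)

`Literature.Analysis.FluidPDE.BilliardTensorMeasureDivFree` proved `⟨M, ∇Ψ⟩ = 0` for test fields
vanishing on the slices `t = a, b`. Here the general identity is recorded: for every `C¹` test
field `Ψ = (ψ₀, ψ)` with bounded space–time derivatives,

`⟨M, ∇_{t,y}Ψ⟩ = Σ_α (∫ Ψ_α dσ^b_α - ∫ Ψ_α dσ^a_α)`,

where `σ^t_α = Σ_p (u_p)_α(t) δ_{(t, x_p(t))}` (`u_p = (1, v_p)`) is the **slice measure** at time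
`t`. In the language of Compensated Integrability (Serre 2024 §5 (16): "`Div S` consists in … the
restriction of its first column to the initial and final hyperplanes"): the row-wise divergence of
`M` extended by zero outside `(a, b)` is the vector measure `σ^a - σ^b`, of total mass at most
`2 (N + √N √(2E))` (`abs_stMomentumObservable_le`).

* `IsHardSphereTrajectory.pairing_billiardTensor_stGradMatrix_eq` — `⟨M, ∇Ψ⟩ =
  ∫_a^b stMomentumStreaming + collitonPairing` (the identification behind the capstone, exported);
* `sliceEntry γ t α` — the signed measure `Σ_p (u_p)_α(t) δ_{(t, x_p(t))}` on `ℝ × T^d`;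
  `integral_sliceEntry` — `∫ g dσ^t_α = Σ_p (u_p)_α g(t, x_p)`;
* `sum_integral_sliceEntry` — `Σ_α ∫ Ψ_α dσ^t_α = stMomentumObservable ψ₀ ψ t (γ t)`;
* **`IsHardSphereTrajectory.pairing_billiardTensor_stGradMatrix_eq_slices`** — the displayed
  identity (`Div M = σ^a - σ^b`).

## References

* D. Serre, *Compensated integrability on tori; a priori estimate for space-periodic gas flows*,
  C. R. Math. Acad. Sci. Paris 362 (2024) 1425–1444, §5 (16), p. 1439. [Serre2024]
-/

open Set Filter Function MeasureTheory
open scoped InnerProductSpace Topology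

namespace Literature.Analysis.FluidPDE

noncomputable section

open Literature.Analysis.FunctionSpaces

variable {d : Type*} [Fintype d] [DecidableEq d] {N : ℕ}

/-! ## The general pairing identity -/

namespace IsHardSphereTrajectory

variable {ε : ℝ} {γ : ℝ → Config N d (UnitAddTorus d)}

/-- **`⟨M, ∇Ψ⟩ = ∫_a^b stMomentumStreaming + collitonPairing`** for every `C¹` test field with
bounded space–time derivatives (no vanishing condition): the closed form of the pairing
(`pairing_billiardTensor`) contracted with `∇Ψ` (`sum_stVec_mul_stGradMatrix`,
`sum_stVec_zero_mul_stGradMatrix`, `Torus.stFDeriv_inr`). [cite: Serre2024, §5 p. 1438] -/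
theorem pairing_billiardTensor_stGradMatrix_eq
    (h : IsHardSphereTrajectory (Torus.geometry d) ε N γ) {ψ₀ : ℝ → UnitAddTorus d → ℝ}
    {ψ : ℝ → UnitAddTorus d → EuclideanSpace ℝ d} (hψ₀ : ContDiff ℝ 1 (Torus.stLift ψ₀))
    (hψ : ContDiff ℝ 1 (Torus.stLift ψ)) {C : ℝ} (hb₀ : ∀ p, ‖fderiv ℝ (Torus.stLift ψ₀) p‖ ≤ C)
    (hb : ∀ p, ‖fderiv ℝ (Torus.stLift ψ) p‖ ≤ C) {a b : ℝ} (hab : a ≤ b) :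
    (billiardTensor ε γ a b).pairing (stGradMatrix ψ₀ ψ) =
      (∫ t in a..b, stMomentumStreaming ψ₀ ψ t (γ t)) + collitonPairing ε ψ γ a b := by
  classical
  obtain ⟨hGm, hGC⟩ := stGradMatrix_measurable_and_bounded hψ₀ hψ hb₀ hb
  rw [h.pairing_billiardTensor a b hGm hGC]
  -- (1) the particle part is `∫_a^b stMomentumStreaming`
  set f : Option d → Option d → Fin N → ℝ → ℝ := fun α β p t =>
    stGradMatrix ψ₀ ψ (graphMap γ p t) α β * particleDensity γ p α β t with hf
  have hint : ∀ (p : Fin N) (α β : Option d), IntegrableOn (f α β p) (Icc a b) volume := by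
    intro p α β
    exact (h.integrable_particleDensity p α β a b).bdd_mul
      ((hGm α β).comp (h.measurable_graphMap p)).aestronglyMeasurable
      (ae_of_all _ fun t => by rw [Real.norm_eq_abs]; exact hGC _ α β)
  have hswap : (∑ α : Option d, ∑ β : Option d, ∑ p : Fin N, ∫ t in Icc a b, f α β p t) =
      ∫ t in Icc a b, ∑ α : Option d, ∑ β : Option d, ∑ p : Fin N, f α β p t := by
    rw [integral_finsetSum _ (fun α _ => integrable_finsetSum _ fun β _ =>
      integrable_finsetSum _ fun p _ => hint p α β)]
    refine Finset.sum_congr rfl fun α _ => ?_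
    rw [integral_finsetSum _ (fun β _ => integrable_finsetSum _ fun p _ => hint p α β)]
    refine Finset.sum_congr rfl fun β _ => ?_
    rw [integral_finsetSum _ (fun p _ => hint p α β)]
  have hpt : ∀ t, ∑ α : Option d, ∑ β : Option d, ∑ p : Fin N, f α β p t =
      stMomentumStreaming ψ₀ ψ t (γ t) := by
    intro t
    calc ∑ α : Option d, ∑ β : Option d, ∑ p : Fin N, f α β p t
        = ∑ α : Option d, ∑ p : Fin N, ∑ β : Option d, f α β p t :=
          Finset.sum_congr rfl fun α _ => Finset.sum_comm
      _ = ∑ p : Fin N, ∑ α : Option d, ∑ β : Option d, f α β p t := Finset.sum_comm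
      _ = ∑ p : Fin N, (Torus.stFDeriv ψ₀ t (γ t p).1 (1, (γ t p).2) +
            ⟪Torus.stFDeriv ψ t (γ t p).1 (1, (γ t p).2), (γ t p).2⟫_ℝ) :=
          Finset.sum_congr rfl fun p _ => sum_stVec_mul_stGradMatrix ψ₀ ψ (graphMap γ p t) (γ t p).2
      _ = stMomentumStreaming ψ₀ ψ t (γ t) := rfl
  have hpart : (∑ α : Option d, ∑ β : Option d, ∑ p : Fin N, ∫ t in Icc a b, f α β p t) =
      ∫ t in a..b, stMomentumStreaming ψ₀ ψ t (γ t) := by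
    rw [hswap, intervalIntegral.integral_of_le hab, ← integral_Icc_eq_integral_Ioc]
    exact setIntegral_congr_fun measurableSet_Icc fun t _ => hpt t
  -- (2) the colliton part is `collitonPairing`
  have hcolpt : ∀ (t : ℝ) (q : Fin N × Fin N) (y : UnitAddTorus d),
      ∑ α : Option d, ∑ β : Option d,
        collitonWeight ε (leftLim γ t) (γ t) q.1 α β * stGradMatrix ψ₀ ψ (t, y) α β =
      2⁻¹ * (ε / ‖(γ t q.1).2 - (leftLim γ t q.1).2‖) *
        ⟪Torus.fderiv (ψ t) y ((γ t q.1).2 - (leftLim γ t q.1).2),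
          (γ t q.1).2 - (leftLim γ t q.1).2⟫_ℝ := by
    intro t q y
    rw [← Torus.stFDeriv_inr hψ t y, ← sum_stVec_zero_mul_stGradMatrix ψ₀ ψ (t, y), Finset.mul_sum]
    refine Finset.sum_congr rfl fun α _ => ?_
    rw [Finset.mul_sum]
    refine Finset.sum_congr rfl fun β _ => ?_
    simp only [collitonWeight]
    ring
  have hcolint : ∀ (t : ℝ) (q : Fin N × Fin N) (α β : Option d), IntegrableOn
      (fun s : ℝ => stGradMatrix ψ₀ ψ
        (t, (γ t q.2).1 + Torus.proj (s • (Torus.geometry d).sepVec (γ t q.1).1 (γ t q.2).1)) α β)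
      (Icc (0 : ℝ) 1) volume := by
    intro t q α β
    refine IntegrableOn.of_bound measure_Icc_lt_top ?_ C (ae_of_all _ fun s => ?_)
    · exact ((hGm α β).comp (measurable_segmentMap t _ _)).aestronglyMeasurable
    · rw [Real.norm_eq_abs]; exact hGC _ α β
  have hcolterm : ∀ (t : ℝ) (q : Fin N × Fin N),
      ∑ α : Option d, ∑ β : Option d, collitonWeight ε (leftLim γ t) (γ t) q.1 α β *
        ∫ s in Icc (0 : ℝ) 1, stGradMatrix ψ₀ ψ
          (t, (γ t q.2).1 + Torus.proj (s • (Torus.geometry d).sepVec (γ t q.1).1 (γ t q.2).1)) α β =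
      collitonKernel ε (ψ t) q.1 q.2 (leftLim γ t) (γ t) := by
    intro t q
    set Gs : Option d → Option d → ℝ → ℝ := fun α β s => stGradMatrix ψ₀ ψ
      (t, (γ t q.2).1 + Torus.proj (s • (Torus.geometry d).sepVec (γ t q.1).1 (γ t q.2).1)) α β with hGs
    set w : Option d → Option d → ℝ := fun α β => collitonWeight ε (leftLim γ t) (γ t) q.1 α β with hw
    have hI : ∀ α β, IntegrableOn (fun s => w α β * Gs α β s) (Icc (0 : ℝ) 1) volume :=
      fun α β => (hcolint t q α β).const_mul _
    calc ∑ α : Option d, ∑ β : Option d, w α β * ∫ s in Icc (0 : ℝ) 1, Gs α β s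
        = ∑ α : Option d, ∑ β : Option d, ∫ s in Icc (0 : ℝ) 1, w α β * Gs α β s :=
          Finset.sum_congr rfl fun α _ => Finset.sum_congr rfl fun β _ => (integral_const_mul _ _).symm
      _ = ∑ α : Option d, ∫ s in Icc (0 : ℝ) 1, ∑ β : Option d, w α β * Gs α β s :=
          Finset.sum_congr rfl fun α _ => (integral_finsetSum _ fun β _ => hI α β).symm
      _ = ∫ s in Icc (0 : ℝ) 1, ∑ α : Option d, ∑ β : Option d, w α β * Gs α β s :=
          (integral_finsetSum _ fun α _ => integrable_finsetSum _ fun β _ => hI α β).symm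
      _ = ∫ s in Icc (0 : ℝ) 1, 2⁻¹ * (ε / ‖(γ t q.1).2 - (leftLim γ t q.1).2‖) *
            ⟪Torus.fderiv (ψ t) ((γ t q.2).1 +
                Torus.proj (s • (Torus.geometry d).sepVec (γ t q.1).1 (γ t q.2).1))
              ((γ t q.1).2 - (leftLim γ t q.1).2), (γ t q.1).2 - (leftLim γ t q.1).2⟫_ℝ :=
          setIntegral_congr_fun measurableSet_Icc fun s _ => hcolpt t q _
      _ = collitonKernel ε (ψ t) q.1 q.2 (leftLim γ t) (γ t) := by
          rw [integral_const_mul, collitonKernel, intervalIntegral.integral_of_le zero_le_one,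
            integral_Icc_eq_integral_Ioc]
  have hcoll : (∑ α : Option d, ∑ β : Option d, ∑ t ∈ (h.finite_collisionTimes_inter_Ioc a b).toFinset,
      ∑ q ∈ collidingPairs (Torus.geometry d) ε (γ t),
        collitonWeight ε (leftLim γ t) (γ t) q.1 α β *
          ∫ s in Icc (0 : ℝ) 1, stGradMatrix ψ₀ ψ
            (t, (γ t q.2).1 + Torus.proj (s • (Torus.geometry d).sepVec (γ t q.1).1 (γ t q.2).1)) α β) =
      collitonPairing ε ψ γ a b := by
    rw [collitonPairing, finsum_mem_eq_finite_toFinset_sum _ (h.finite_collisionTimes_inter_Ioc a b)]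
    calc _ = ∑ α : Option d, ∑ t ∈ (h.finite_collisionTimes_inter_Ioc a b).toFinset, ∑ β : Option d,
          ∑ q ∈ collidingPairs (Torus.geometry d) ε (γ t),
            collitonWeight ε (leftLim γ t) (γ t) q.1 α β *
              ∫ s in Icc (0 : ℝ) 1, stGradMatrix ψ₀ ψ
                (t, (γ t q.2).1 + Torus.proj (s • (Torus.geometry d).sepVec (γ t q.1).1 (γ t q.2).1)) α β :=
          Finset.sum_congr rfl fun α _ => Finset.sum_comm
      _ = ∑ t ∈ (h.finite_collisionTimes_inter_Ioc a b).toFinset, ∑ α : Option d, ∑ β : Option d,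
          ∑ q ∈ collidingPairs (Torus.geometry d) ε (γ t),
            collitonWeight ε (leftLim γ t) (γ t) q.1 α β *
              ∫ s in Icc (0 : ℝ) 1, stGradMatrix ψ₀ ψ
                (t, (γ t q.2).1 + Torus.proj (s • (Torus.geometry d).sepVec (γ t q.1).1 (γ t q.2).1)) α β :=
          Finset.sum_comm
      _ = ∑ t ∈ (h.finite_collisionTimes_inter_Ioc a b).toFinset,
          ∑ q ∈ collidingPairs (Torus.geometry d) ε (γ t), collitonKernel ε (ψ t) q.1 q.2 (leftLim γ t) (γ t) := by
          refine Finset.sum_congr rfl fun t _ => ?_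
          calc _ = ∑ α : Option d, ∑ q ∈ collidingPairs (Torus.geometry d) ε (γ t), ∑ β : Option d,
                collitonWeight ε (leftLim γ t) (γ t) q.1 α β *
                  ∫ s in Icc (0 : ℝ) 1, stGradMatrix ψ₀ ψ
                    (t, (γ t q.2).1 + Torus.proj (s • (Torus.geometry d).sepVec (γ t q.1).1 (γ t q.2).1)) α β :=
                Finset.sum_congr rfl fun α _ => Finset.sum_comm
            _ = ∑ q ∈ collidingPairs (Torus.geometry d) ε (γ t), ∑ α : Option d, ∑ β : Option d,
                collitonWeight ε (leftLim γ t) (γ t) q.1 α β *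
                  ∫ s in Icc (0 : ℝ) 1, stGradMatrix ψ₀ ψ
                    (t, (γ t q.2).1 + Torus.proj (s • (Torus.geometry d).sepVec (γ t q.1).1 (γ t q.2).1)) α β :=
                Finset.sum_comm
            _ = _ := Finset.sum_congr rfl fun q _ => hcolterm t q
  rw [hpart, hcoll]

end IsHardSphereTrajectory

/-! ## The slice measures -/

/-- The **slice measure** entry `σ^t_α = Σ_p (u_p)_α(t) δ_{(t, x_p(t))}` (`u_p = (1, v_p(t))`):
the normal trace of the particle part of `M` on the hyperplane `{t} × T^d`
(Serre 2024 §5 (16)). [cite: Serre2024, §5 (16)] -/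
def sliceEntry (γ : ℝ → Config N d (UnitAddTorus d)) (t : ℝ) (α : Option d) :
    SignedMeasure (ℝ × UnitAddTorus d) :=
  ∑ p : Fin N, VectorMeasure.dirac ((t, (γ t p).1) : ℝ × UnitAddTorus d) (stVec 1 (γ t p).2 α)

omit [Fintype d] [DecidableEq d] in
/-- Integration against a slice entry: `∫ g dσ^t_α = Σ_p (u_p)_α g(t, x_p(t))` for measurable `g`.
[folklore] -/
theorem integral_sliceEntry (γ : ℝ → Config N d (UnitAddTorus d)) (t : ℝ) (α : Option d)
    {g : ℝ × UnitAddTorus d → ℝ} (hg : Measurable g) :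
    ∫ᵛ q, g q ∂<•(sliceEntry γ t α) = ∑ p : Fin N, stVec 1 (γ t p).2 α * g (t, (γ t p).1) := by
  have hint : ∀ p : Fin N, (VectorMeasure.dirac ((t, (γ t p).1) : ℝ × UnitAddTorus d)
      (stVec 1 (γ t p).2 α)).Integrable g := by
    intro p
    unfold VectorMeasure.Integrable
    rw [VectorMeasure.variation_dirac]
    exact (integrable_dirac' hg.stronglyMeasurable (by simp)).smul_measure (by simp)
  rw [sliceEntry, VectorMeasure.integral_finsetSum_vectorMeasure fun p _ => hint p]
  refine Finset.sum_congr rfl fun p _ => ?_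
  rw [VectorMeasure.integral_dirac' hg.stronglyMeasurable]
  simp only [ContinuousLinearMap.flip_apply, ContinuousLinearMap.lsmul_apply, smul_eq_mul]

omit [DecidableEq d] in
/-- The slice measures tested against `Ψ = (ψ₀, ψ)` give the space–time momentum observable:
`Σ_α ∫ Ψ_α dσ^t_α = Σ_p (ψ₀(t, x_p) + ⟪ψ(t, x_p), v_p⟫) = stMomentumObservable ψ₀ ψ t (γ t)`.
[folklore] -/
theorem sum_integral_sliceEntry (γ : ℝ → Config N d (UnitAddTorus d)) (t : ℝ)
    {ψ₀ : ℝ → UnitAddTorus d → ℝ} {ψ : ℝ → UnitAddTorus d → EuclideanSpace ℝ d}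
    (hψ₀ : Measurable (Torus.stLift ψ₀ ∘ fun q : ℝ × UnitAddTorus d => (q.1, Torus.repr q.2)))
    (hψ : ∀ k : d, Measurable fun q : ℝ × UnitAddTorus d => ψ q.1 q.2 k) :
    ∑ α : Option d, ∫ᵛ q, (α.elim (ψ₀ q.1 q.2) fun k => ψ q.1 q.2 k) ∂<•(sliceEntry γ t α) =
      stMomentumObservable ψ₀ ψ t (γ t) := by
  have hm0 : Measurable fun q : ℝ × UnitAddTorus d => ψ₀ q.1 q.2 := by
    have heq : (fun q : ℝ × UnitAddTorus d => ψ₀ q.1 q.2) =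
        Torus.stLift ψ₀ ∘ fun q : ℝ × UnitAddTorus d => (q.1, Torus.repr q.2) := by
      funext q
      simp only [Function.comp_apply, Torus.stLift_apply, Torus.proj_repr]
    rw [heq]
    exact hψ₀
  rw [Fintype.sum_option]
  simp only [Option.elim_none, Option.elim_some]
  rw [integral_sliceEntry γ t none hm0]
  have hk : ∀ k : d, ∫ᵛ q, ψ q.1 q.2 k ∂<•(sliceEntry γ t (some k)) =
      ∑ p : Fin N, (γ t p).2 k * ψ t (γ t p).1 k := fun k => by
    rw [integral_sliceEntry γ t (some k) (hψ k)]
    rfl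
  simp only [hk, stVec_none, one_mul]
  rw [Finset.sum_comm, ← Finset.sum_add_distrib, stMomentumObservable]
  refine Finset.sum_congr rfl fun p _ => ?_
  rw [PiLp.inner_apply, add_right_inj]
  exact Finset.sum_congr rfl fun k _ => by rw [RCLike.inner_apply, conj_trivial, mul_comm]

namespace IsHardSphereTrajectory

variable {ε : ℝ} {γ : ℝ → Config N d (UnitAddTorus d)}

/-- **`Div M = σ^a - σ^b` (Serre 2024 §5 (16), measure form, tested).** Along a hard-sphere
trajectory on `T^d`, for every `C¹` test field `Ψ = (ψ₀, ψ)` with bounded space–time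
derivatives and `a ≤ b`,
`⟨M, ∇_{t,y}Ψ⟩ = Σ_α (∫ Ψ_α dσ^b_α - ∫ Ψ_α dσ^a_α)`: the row-wise divergence of `M`
(extended by zero) is carried by the two time slices, with densities `∓ Σ_p (u_p)_α δ_{x_p}`.
[cite: Serre2024, §5 (16)] -/
theorem pairing_billiardTensor_stGradMatrix_eq_slices
    (h : IsHardSphereTrajectory (Torus.geometry d) ε N γ) {ψ₀ : ℝ → UnitAddTorus d → ℝ}
    {ψ : ℝ → UnitAddTorus d → EuclideanSpace ℝ d} (hψ₀ : ContDiff ℝ 1 (Torus.stLift ψ₀))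
    (hψ : ContDiff ℝ 1 (Torus.stLift ψ)) {C : ℝ} (hb₀ : ∀ p, ‖fderiv ℝ (Torus.stLift ψ₀) p‖ ≤ C)
    (hb : ∀ p, ‖fderiv ℝ (Torus.stLift ψ) p‖ ≤ C) {a b : ℝ} (hab : a ≤ b) :
    (billiardTensor ε γ a b).pairing (stGradMatrix ψ₀ ψ) =
      ∑ α : Option d,
        ((∫ᵛ q, (α.elim (ψ₀ q.1 q.2) fun k => ψ q.1 q.2 k) ∂<•(sliceEntry γ b α)) -
          ∫ᵛ q, (α.elim (ψ₀ q.1 q.2) fun k => ψ q.1 q.2 k) ∂<•(sliceEntry γ a α)) := by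
  have hrepr : Measurable fun q : ℝ × UnitAddTorus d => ((q.1, Torus.repr q.2) : ℝ × EuclideanSpace ℝ d) :=
    measurable_fst.prodMk (Torus.measurable_repr.comp measurable_snd)
  have hm0 : Measurable (Torus.stLift ψ₀ ∘ fun q : ℝ × UnitAddTorus d => (q.1, Torus.repr q.2)) :=
    hψ₀.continuous.measurable.comp hrepr
  have hmk : ∀ k : d, Measurable fun q : ℝ × UnitAddTorus d => ψ q.1 q.2 k := by
    intro k
    have heq : (fun q : ℝ × UnitAddTorus d => ψ q.1 q.2 k) =
        (fun y : EuclideanSpace ℝ d => y k) ∘ Torus.stLift ψ ∘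
          fun q : ℝ × UnitAddTorus d => ((q.1, Torus.repr q.2) : ℝ × EuclideanSpace ℝ d) := by
      funext q
      simp only [Function.comp_apply, Torus.stLift_apply, Torus.proj_repr]
    rw [heq]
    exact (EuclideanSpace.proj k).continuous.measurable.comp (hψ.continuous.measurable.comp hrepr)
  rw [Finset.sum_sub_distrib, sum_integral_sliceEntry γ b hm0 hmk, sum_integral_sliceEntry γ a hm0 hmk,
    h.pairing_billiardTensor_stGradMatrix_eq hψ₀ hψ hb₀ hb hab]
  exact h.integral_stMomentumStreaming_add_collitonPairing_eq_sub hψ₀ hψ hab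

end IsHardSphereTrajectory

end

end Literature.Analysis.FluidPDE
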